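import Literature.Topology.FourManifolds.HurwitzDeletionCalculus
import HarnessLib

/-!
# The first-deletion criterion: a necessary condition for Hurwitz–deletion nullity

Topic `Literature/Topology/FourManifolds`; companion of `HurwitzDeletionCalculus.lean`
(`IsHurwitzNull`, `NullStep`, `Deletion`, `letterInv`) and `DehnTwistFactorisation.lean` (`Letter`,
`Letter.toClass`, `HurwitzStep`, `conjWord`, `Move`).  Theorems only; nothing is defined or asserted.

**The criterion** (`IsHurwitzNull.exists_conj_inv`).  Let `w` be a NONEMPTY signed word of Dehn-twist
letters over a page `P` and `H_w = ⟨t_x^{ε} : (x, ε) ∈ w⟩ ≤ Mod(P, ∂P)` the subgroup generated by the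
classes of its letters.  If `w` is Hurwitz-null then `w` contains two letters `x`, `y` whose classes
are mutually inverse UP TO CONJUGATION BY AN ELEMENT OF `H_w`:
`y.toClass = h · x.toClass⁻¹ · h⁻¹`, `h ∈ H_w`.  Reason: along the null sequence every letter of every
word is an `H`-conjugate of a letter of the original word (a Hurwitz move replaces a letter by its
conjugate by the class of a neighbouring letter; a global conjugation conjugates everything, the
subgroup included), the subgroups only shrink, and the first deletion needs two adjacent letters
`(c, ε)(d, ¬ε)` with `t_c = t_d`, i.e. mutually inverse classes.  For a two-factorisation word
`w = a ++ letterInv b` of positive words (a conjugate of a positive twist is never the inverse of a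
positive twist unless the curves match): SOME VANISHING CYCLE OF `b` LIES IN THE `H_w`-ORBIT OF SOME
VANISHING CYCLE OF `a` — `H`-conjugacy of twists, strictly finer than `Mod(P, ∂P)`-conjugacy (the
"type" of `Negative/HurwitzTypeCount.lean`), and not an abelian invariant.  This is the standing
necessary condition that every instance of the apex `stub_hurwitzNullConnectedBinding` of the line
`hurwitz-deletion-presentation` (crux `ConvexBisection.AcyclicBisectionRigidity`,
stmt-SmoothPoincare4-10507) must pass, and the certificate generator for refuting it: a word failing
the criterion (checkable in finite quotients of `Mod(P, ∂P)`, e.g. `Sp(2g, 𝔽_p)`) is NOT null.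
(The same statement for an abstract move set on words over a group is
`exists_conj_inv_of_monotoneReducible` of the crux's `Disproof.lean`, §13e; here it is proved for
the tree's calculus on honest letters, where global conjugation moves the subgroup.)

## References

* D. Auroux, *A stable classification of Lefschetz fibrations*, Geom. Topol. 9 (2005), §2 (Hurwitz
  moves act by conjugation within the subgroup generated by the factors). [Auroux2005]
* R. E. Gompf, A. I. Stipsicz, *4-Manifolds and Kirby Calculus* (1999), §8.2, §8.4. [GompfStipsiczGSM1999]
-/

open scoped Manifold ContDiff Topology
open Set Function

noncomputable section

namespace Literature.Topology.FourManifolds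

section Criterion

variable {P : Type*} [TopologicalSpace P] [T2Space P] [ChartedSpace (EuclideanHalfSpace 2) P]
  [IsManifold (𝓡∂ 2) ∞ P] {o : SmoothOrientation (𝓡∂ 2) P}

/-! ### Classes of moved and conjugated letters -/

/-- **The class of a globally conjugated letter is the conjugate class**:
`t_{g(c)}^{ε} = [g] t_c^{ε} [g]⁻¹`. [cite: Auroux2005, §2] -/
theorem Letter.toClass_mapRel (g : DiffRelBoundary (𝓡∂ 2) P)
    (hg : g ∈ RelDiffeo.orientedSubgroup ((𝓡∂ 2).boundary P) o) (x : Letter P o) :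
    Letter.toClass (x.1.mapRel g hg, x.2) =
      MappingClassGroup.mk _ _ _ g * x.toClass * (MappingClassGroup.mk _ _ _ g)⁻¹ := by
  obtain ⟨d, _ | _⟩ := x
  · rw [Letter.toClass_false, Letter.toClass_false, TwistCurve.twist_mapRel]
    group
  · rw [Letter.toClass_true, Letter.toClass_true, TwistCurve.twist_mapRel]

omit [T2Space P] in
/-- Letters of a globally conjugated word are the conjugated letters. [folklore] -/
theorem mem_conjWord_iff (g : DiffRelBoundary (𝓡∂ 2) P)
    (hg : g ∈ RelDiffeo.orientedSubgroup ((𝓡∂ 2).boundary P) o) (w : List (Letter P o))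
    (z : Letter P o) : z ∈ conjWord g hg w ↔ ∃ x ∈ w, z = (x.1.mapRel g hg, x.2) := by
  simp only [conjWord, List.mem_map]
  constructor
  · rintro ⟨x, hx, rfl⟩; exact ⟨x, hx, rfl⟩
  · rintro ⟨x, hx, rfl⟩; exact ⟨x, hx, rfl⟩

/-! ### The letter subgroup `H_w` -/

/-- **The letter subgroup of a conjugated word is the conjugate subgroup**:
`H_{(w)_g} = [g] H_w [g]⁻¹`. [cite: Auroux2005, §2] -/
theorem closure_toClass_conjWord (g : DiffRelBoundary (𝓡∂ 2) P)
    (hg : g ∈ RelDiffeo.orientedSubgroup ((𝓡∂ 2).boundary P) o) (w : List (Letter P o)) :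
    Subgroup.closure {c | ∃ z ∈ conjWord g hg w, c = Letter.toClass z} =
      (Subgroup.closure {c | ∃ x ∈ w, c = Letter.toClass x}).map
        (MulAut.conj (MappingClassGroup.mk _ _ _ g)).toMonoidHom := by
  rw [MonoidHom.map_closure]
  congr 1
  ext c
  simp only [Set.mem_setOf_eq, Set.mem_image, MulEquiv.coe_toMonoidHom, MulAut.conj_apply]
  constructor
  · rintro ⟨z, hz, rfl⟩
    obtain ⟨x, hx, rfl⟩ := (mem_conjWord_iff g hg w z).1 hz
    exact ⟨x.toClass, ⟨x, hx, rfl⟩, (Letter.toClass_mapRel g hg x).symm⟩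
  · rintro ⟨c', ⟨x, hx, rfl⟩, rfl⟩
    exact ⟨(x.1.mapRel g hg, x.2), (mem_conjWord_iff g hg w _).2 ⟨x, hx, rfl⟩,
      (Letter.toClass_mapRel g hg x).symm⟩

/-- **A Hurwitz step does not change the letter subgroup** (the new letters are conjugates of old
letters by old letters, and conversely). [cite: Auroux2005, §2] -/
theorem HurwitzStep.closure_toClass_eq {w w' : List (Letter P o)} (h : HurwitzStep w w') :
    Subgroup.closure {c | ∃ x ∈ w', c = Letter.toClass x} =
      Subgroup.closure {c | ∃ x ∈ w, c = Letter.toClass x} := by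
  obtain ⟨pre, suf, x, y, rfl, rfl | rfl⟩ := h
  · apply le_antisymm
    · refine (Subgroup.closure_le _).2 ?_
      rintro c ⟨z, hz, rfl⟩
      simp only [List.mem_append, List.mem_cons] at hz
      have hx : x.toClass ∈ Subgroup.closure {c | ∃ x' ∈ pre ++ x :: y :: suf, c = Letter.toClass x'} :=
        Subgroup.subset_closure ⟨x, by simp, rfl⟩
      have hy : y.toClass ∈ Subgroup.closure {c | ∃ x' ∈ pre ++ x :: y :: suf, c = Letter.toClass x'} :=
        Subgroup.subset_closure ⟨y, by simp, rfl⟩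
      rcases hz with hz | rfl | rfl | hz
      · exact Subgroup.subset_closure ⟨z, by simp [hz], rfl⟩
      · rw [SetLike.mem_coe, Letter.toClass_act]
        exact Subgroup.mul_mem _ (Subgroup.mul_mem _ hx hy) (Subgroup.inv_mem _ hx)
      · exact hx
      · exact Subgroup.subset_closure ⟨z, by simp [hz], rfl⟩
    · refine (Subgroup.closure_le _).2 ?_
      rintro c ⟨z, hz, rfl⟩
      simp only [List.mem_append, List.mem_cons] at hz
      have hx : x.toClass ∈ Subgroup.closure
          {c | ∃ x' ∈ pre ++ (x.act y.1, y.2) :: x :: suf, c = Letter.toClass x'} :=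
        Subgroup.subset_closure ⟨x, by simp, rfl⟩
      have hxy : Letter.toClass (x.act y.1, y.2) ∈ Subgroup.closure
          {c | ∃ x' ∈ pre ++ (x.act y.1, y.2) :: x :: suf, c = Letter.toClass x'} :=
        Subgroup.subset_closure ⟨_, by simp, rfl⟩
      rw [Letter.toClass_act] at hxy
      rcases hz with hz | rfl | rfl | hz
      · exact Subgroup.subset_closure ⟨z, by simp [hz], rfl⟩
      · exact hx
      · -- y.toClass = x⁻¹ (x y x⁻¹) x
        have : z.toClass = x.toClass⁻¹ * (x.toClass * z.toClass * x.toClass⁻¹) * x.toClass := by group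
        rw [SetLike.mem_coe, this]
        exact Subgroup.mul_mem _ (Subgroup.mul_mem _ (Subgroup.inv_mem _ hx) hxy) hx
      · exact Subgroup.subset_closure ⟨z, by simp [hz], rfl⟩
  · apply le_antisymm
    · refine (Subgroup.closure_le _).2 ?_
      rintro c ⟨z, hz, rfl⟩
      simp only [List.mem_append, List.mem_cons] at hz
      have hx : x.toClass ∈ Subgroup.closure {c | ∃ x' ∈ pre ++ x :: y :: suf, c = Letter.toClass x'} :=
        Subgroup.subset_closure ⟨x, by simp, rfl⟩
      have hy : y.toClass ∈ Subgroup.closure {c | ∃ x' ∈ pre ++ x :: y :: suf, c = Letter.toClass x'} :=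
        Subgroup.subset_closure ⟨y, by simp, rfl⟩
      rcases hz with hz | rfl | rfl | hz
      · exact Subgroup.subset_closure ⟨z, by simp [hz], rfl⟩
      · exact hy
      · rw [SetLike.mem_coe, Letter.toClass_act, Letter.toClass_inv]
        exact Subgroup.mul_mem _ (Subgroup.mul_mem _ (Subgroup.inv_mem _ hy) hx)
          (by simpa using hy)
      · exact Subgroup.subset_closure ⟨z, by simp [hz], rfl⟩
    · refine (Subgroup.closure_le _).2 ?_
      rintro c ⟨z, hz, rfl⟩
      simp only [List.mem_append, List.mem_cons] at hz
      have hy : y.toClass ∈ Subgroup.closure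
          {c | ∃ x' ∈ pre ++ y :: (y.inv.act x.1, x.2) :: suf, c = Letter.toClass x'} :=
        Subgroup.subset_closure ⟨y, by simp, rfl⟩
      have hyx : Letter.toClass (y.inv.act x.1, x.2) ∈ Subgroup.closure
          {c | ∃ x' ∈ pre ++ y :: (y.inv.act x.1, x.2) :: suf, c = Letter.toClass x'} :=
        Subgroup.subset_closure ⟨_, by simp, rfl⟩
      rw [Letter.toClass_act, Letter.toClass_inv] at hyx
      rcases hz with hz | rfl | rfl | hz
      · exact Subgroup.subset_closure ⟨z, by simp [hz], rfl⟩
      · -- x.toClass = y (y⁻¹ x y) y⁻¹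
        have : z.toClass = y.toClass * (y.toClass⁻¹ * z.toClass * y.toClass⁻¹⁻¹) * y.toClass⁻¹ := by
          group
        rw [SetLike.mem_coe, this]
        exact Subgroup.mul_mem _ (Subgroup.mul_mem _ hy hyx) (Subgroup.inv_mem _ hy)
      · exact hy
      · exact Subgroup.subset_closure ⟨z, by simp [hz], rfl⟩

/-- **After a Hurwitz step every letter is a conjugate of an old letter by an element of the letter
subgroup** (`x y x⁻¹` by `x`; the untouched letters by `1`). [cite: Auroux2005, §2] -/
theorem HurwitzStep.exists_conj_of_mem {w w' : List (Letter P o)} (h : HurwitzStep w w')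
    {z : Letter P o} (hz : z ∈ w') :
    ∃ t ∈ w, ∃ u ∈ Subgroup.closure {c | ∃ x ∈ w, c = Letter.toClass x},
      z.toClass = u * t.toClass * u⁻¹ := by
  obtain ⟨pre, suf, x, y, rfl, rfl | rfl⟩ := h
  · simp only [List.mem_append, List.mem_cons] at hz
    rcases hz with hz | rfl | rfl | hz
    · exact ⟨z, by simp [hz], 1, one_mem _, by group⟩
    · exact ⟨y, by simp, x.toClass, Subgroup.subset_closure ⟨x, by simp, rfl⟩, Letter.toClass_act x y⟩
    · exact ⟨z, by simp, 1, one_mem _, by group⟩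
    · exact ⟨z, by simp [hz], 1, one_mem _, by group⟩
  · simp only [List.mem_append, List.mem_cons] at hz
    rcases hz with hz | rfl | rfl | hz
    · exact ⟨z, by simp [hz], 1, one_mem _, by group⟩
    · exact ⟨z, by simp, 1, one_mem _, by group⟩
    · refine ⟨x, by simp, y.toClass⁻¹, Subgroup.inv_mem _ (Subgroup.subset_closure ⟨y, by simp, rfl⟩), ?_⟩
      rw [Letter.toClass_act, Letter.toClass_inv]
    · exact ⟨z, by simp [hz], 1, one_mem _, by group⟩

/-- **Before a Hurwitz step every letter is a conjugate of a new letter by an element of the letter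
subgroup** (the step is invertible: `y = x⁻¹ (x y x⁻¹) x`). [cite: Auroux2005, §2] -/
theorem HurwitzStep.exists_conj_of_mem' {w w' : List (Letter P o)} (h : HurwitzStep w w')
    {z : Letter P o} (hz : z ∈ w) :
    ∃ t ∈ w', ∃ u ∈ Subgroup.closure {c | ∃ x ∈ w', c = Letter.toClass x},
      z.toClass = u * t.toClass * u⁻¹ := by
  obtain ⟨pre, suf, x, y, rfl, rfl | rfl⟩ := h
  · simp only [List.mem_append, List.mem_cons] at hz
    rcases hz with hz | rfl | rfl | hz
    · exact ⟨z, by simp [hz], 1, one_mem _, by group⟩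
    · exact ⟨z, by simp, 1, one_mem _, by group⟩
    · refine ⟨(x.act z.1, z.2), by simp, x.toClass⁻¹,
        Subgroup.inv_mem _ (Subgroup.subset_closure ⟨x, by simp, rfl⟩), ?_⟩
      rw [Letter.toClass_act]; group
    · exact ⟨z, by simp [hz], 1, one_mem _, by group⟩
  · simp only [List.mem_append, List.mem_cons] at hz
    rcases hz with hz | rfl | rfl | hz
    · exact ⟨z, by simp [hz], 1, one_mem _, by group⟩
    · refine ⟨(y.inv.act z.1, z.2), by simp, y.toClass, Subgroup.subset_closure ⟨y, by simp, rfl⟩, ?_⟩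
      rw [Letter.toClass_act, Letter.toClass_inv]; group
    · exact ⟨z, by simp, 1, one_mem _, by group⟩
    · exact ⟨z, by simp [hz], 1, one_mem _, by group⟩

/-! ### Transfer of the criterion along the moves -/

/-- **Transfer**: if every letter of `w'` is an `H_w`-conjugate of a letter of `w` and `H_{w'} ≤ H_w`,
then the criterion for `w'` implies the criterion for `w`. [folklore] -/
theorem exists_conj_inv_of_transfer {w w' : List (Letter P o)}
    (hletters : ∀ z ∈ w', ∃ t ∈ w, ∃ u ∈ Subgroup.closure {c | ∃ x ∈ w, c = Letter.toClass x},
      z.toClass = u * t.toClass * u⁻¹)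
    (hsub : Subgroup.closure {c | ∃ x ∈ w', c = Letter.toClass x} ≤
      Subgroup.closure {c | ∃ x ∈ w, c = Letter.toClass x})
    (h : ∃ x ∈ w', ∃ y ∈ w', ∃ g ∈ Subgroup.closure {c | ∃ z ∈ w', c = Letter.toClass z},
      y.toClass = g * x.toClass⁻¹ * g⁻¹) :
    ∃ x ∈ w, ∃ y ∈ w, ∃ g ∈ Subgroup.closure {c | ∃ z ∈ w, c = Letter.toClass z},
      y.toClass = g * x.toClass⁻¹ * g⁻¹ := by
  obtain ⟨x', hx', y', hy', g', hg', hyeq⟩ := h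
  obtain ⟨x, hx, u, hu, hxu⟩ := hletters x' hx'
  obtain ⟨y, hy, v, hv, hyv⟩ := hletters y' hy'
  refine ⟨x, hx, y, hy, v⁻¹ * g' * u, ?_, ?_⟩
  · exact Subgroup.mul_mem _ (Subgroup.mul_mem _ (Subgroup.inv_mem _ hv) (hsub hg')) hu
  · rw [hxu, hyv] at hyeq
    calc y.toClass = v⁻¹ * (v * y.toClass * v⁻¹) * v := by group
      _ = v⁻¹ * (g' * (u * x.toClass * u⁻¹)⁻¹ * g'⁻¹) * v := by rw [hyeq]
      _ = v⁻¹ * g' * u * x.toClass⁻¹ * (v⁻¹ * g' * u)⁻¹ := by group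

/-- **The criterion is invariant under global conjugation** (pull back along `g`).
[cite: Auroux2005, §2] -/
theorem exists_conj_inv_of_conjWord (g : DiffRelBoundary (𝓡∂ 2) P)
    (hg : g ∈ RelDiffeo.orientedSubgroup ((𝓡∂ 2).boundary P) o) {w : List (Letter P o)}
    (h : ∃ x ∈ conjWord g hg w, ∃ y ∈ conjWord g hg w,
      ∃ k ∈ Subgroup.closure {c | ∃ z ∈ conjWord g hg w, c = Letter.toClass z},
        y.toClass = k * x.toClass⁻¹ * k⁻¹) :
    ∃ x ∈ w, ∃ y ∈ w, ∃ k ∈ Subgroup.closure {c | ∃ z ∈ w, c = Letter.toClass z},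
      y.toClass = k * x.toClass⁻¹ * k⁻¹ := by
  obtain ⟨x', hx', y', hy', k', hk', hyeq⟩ := h
  obtain ⟨x, hx, rfl⟩ := (mem_conjWord_iff g hg w x').1 hx'
  obtain ⟨y, hy, rfl⟩ := (mem_conjWord_iff g hg w y').1 hy'
  rw [closure_toClass_conjWord, Subgroup.mem_map] at hk'
  obtain ⟨k, hk, rfl⟩ := hk'
  refine ⟨x, hx, y, hy, k, hk, ?_⟩
  rw [Letter.toClass_mapRel, Letter.toClass_mapRel] at hyeq
  simp only [MulEquiv.coe_toMonoidHom, MulAut.conj_apply] at hyeq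
  set γ := MappingClassGroup.mk _ _ _ g with hγ
  calc y.toClass = γ⁻¹ * (γ * y.toClass * γ⁻¹) * γ := by group
    _ = γ⁻¹ * (γ * k * γ⁻¹ * (γ * x.toClass * γ⁻¹)⁻¹ * (γ * k * γ⁻¹)⁻¹) * γ := by rw [hyeq]
    _ = k * x.toClass⁻¹ * k⁻¹ := by group

/-- **The criterion passes forward under global conjugation** (push along `g`). [cite: Auroux2005, §2] -/
theorem exists_conj_inv_conjWord (g : DiffRelBoundary (𝓡∂ 2) P)
    (hg : g ∈ RelDiffeo.orientedSubgroup ((𝓡∂ 2).boundary P) o) {w : List (Letter P o)}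
    (h : ∃ x ∈ w, ∃ y ∈ w, ∃ k ∈ Subgroup.closure {c | ∃ z ∈ w, c = Letter.toClass z},
      y.toClass = k * x.toClass⁻¹ * k⁻¹) :
    ∃ x ∈ conjWord g hg w, ∃ y ∈ conjWord g hg w,
      ∃ k ∈ Subgroup.closure {c | ∃ z ∈ conjWord g hg w, c = Letter.toClass z},
        y.toClass = k * x.toClass⁻¹ * k⁻¹ := by
  obtain ⟨x, hx, y, hy, k, hk, hyeq⟩ := h
  refine ⟨(x.1.mapRel g hg, x.2), (mem_conjWord_iff g hg w _).2 ⟨x, hx, rfl⟩,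
    (y.1.mapRel g hg, y.2), (mem_conjWord_iff g hg w _).2 ⟨y, hy, rfl⟩,
    (MulAut.conj (MappingClassGroup.mk _ _ _ g)).toMonoidHom k, ?_, ?_⟩
  · rw [closure_toClass_conjWord]
    exact Subgroup.mem_map_of_mem _ hk
  · rw [Letter.toClass_mapRel, Letter.toClass_mapRel, hyeq]
    simp only [MulEquiv.coe_toMonoidHom, MulAut.conj_apply]
    group

/-- **A deletable word satisfies the criterion on the nose** (`h = 1`: the deleted pair
`(c, ε)(d, ¬ε)` with `t_c = t_d` has mutually inverse classes). [folklore] -/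
theorem Deletion.exists_conj_inv {w w' : List (Letter P o)} (h : Deletion w w') :
    ∃ x ∈ w, ∃ y ∈ w, ∃ k ∈ Subgroup.closure {c | ∃ z ∈ w, c = Letter.toClass z},
      y.toClass = k * x.toClass⁻¹ * k⁻¹ := by
  obtain ⟨pre, suf, c, d, ε, rfl, hcd, rfl⟩ := h
  refine ⟨(c, ε), by simp, (d, !ε), by simp, 1, one_mem _, ?_⟩
  cases ε
  · simp [Letter.toClass_true, Letter.toClass_false, hcd]
  · simp [Letter.toClass_true, Letter.toClass_false, hcd]

/-- **One null step transfers the criterion backwards.** [folklore] -/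
theorem NullStep.exists_conj_inv {w w' : List (Letter P o)} (h : NullStep w w')
    (h' : w' ≠ [] → ∃ x ∈ w', ∃ y ∈ w', ∃ k ∈ Subgroup.closure {c | ∃ z ∈ w', c = Letter.toClass z},
      y.toClass = k * x.toClass⁻¹ * k⁻¹) (hw : w ≠ []) :
    ∃ x ∈ w, ∃ y ∈ w, ∃ k ∈ Subgroup.closure {c | ∃ z ∈ w, c = Letter.toClass z},
      y.toClass = k * x.toClass⁻¹ * k⁻¹ := by
  rcases h with hm | hm | hd
  · -- Move w w'
    have hne : w' ≠ [] := by
      intro he; apply hw; have := hm.length_eq; rw [he] at this; simpa using this.symm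
    cases hm with
    | hurwitz hs =>
      exact exists_conj_inv_of_transfer (fun z hz => hs.exists_conj_of_mem hz)
        (le_of_eq hs.closure_toClass_eq) (h' hne)
    | conj g hg w => exact exists_conj_inv_of_conjWord g hg (h' hne)
  · -- Move w' w
    have hne : w' ≠ [] := by
      intro he; apply hw; have := hm.length_eq; rw [he] at this; simpa using this
    cases hm with
    | hurwitz hs =>
      exact exists_conj_inv_of_transfer (fun z hz => hs.exists_conj_of_mem' hz)
        (le_of_eq hs.closure_toClass_eq.symm) (h' hne)
    | conj g hg w' => exact exists_conj_inv_conjWord g hg (h' hne)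
  · exact hd.exists_conj_inv

/-- **THE FIRST-DELETION CRITERION.**  A nonempty Hurwitz-null word contains two letters `x`, `y`
with `y.toClass = h · x.toClass⁻¹ · h⁻¹` for some `h` in the subgroup of `Mod(P, ∂P)` generated by
the classes of its letters.  For `w = a ++ letterInv b` (`a`, `b` positive): some vanishing cycle of
`b` lies in the `H_w`-orbit of some vanishing cycle of `a` (or two letters of one side have
`H_w`-conjugate classes of opposite sign).  A word failing this — decidable in any finite quotient
of `Mod(P, ∂P)` — is NOT Hurwitz-null: the refutation certificate for the apex of the line
`hurwitz-deletion-presentation`. [cite: Auroux2005, §2] -/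
theorem IsHurwitzNull.exists_conj_inv {w : List (Letter P o)} (h : IsHurwitzNull w) (hw : w ≠ []) :
    ∃ x ∈ w, ∃ y ∈ w, ∃ k ∈ Subgroup.closure {c | ∃ z ∈ w, c = Letter.toClass z},
      y.toClass = k * x.toClass⁻¹ * k⁻¹ := by
  unfold IsHurwitzNull at h
  induction h using Relation.ReflTransGen.head_induction_on with
  | refl => exact (hw rfl).elim
  | head hst _ ih => exact hst.exists_conj_inv ih hw

/-- **Contrapositive (the certificate form).**  If NO two letters of a nonempty word have
`H_w`-conjugate mutually inverse classes, the word is not Hurwitz-null. [cite: Auroux2005, §2] -/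
theorem not_isHurwitzNull_of_forall_ne {w : List (Letter P o)} (hw : w ≠ [])
    (h : ∀ x ∈ w, ∀ y ∈ w, ∀ k ∈ Subgroup.closure {c | ∃ z ∈ w, c = Letter.toClass z},
      y.toClass ≠ k * x.toClass⁻¹ * k⁻¹) :
    ¬ IsHurwitzNull w := by
  intro hn
  obtain ⟨x, hx, y, hy, k, hk, hyeq⟩ := hn.exists_conj_inv hw
  exact h x hx y hy k hk hyeq

/-- **Quotient form of the certificate.**  For any group homomorphism `ρ : Mod(P, ∂P) → G` (e.g. to
`Sp(2g, 𝔽_p)` or any finite quotient): if no two letters `x`, `y` of the nonempty word `w` have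
`ρ(y) = γ · ρ(x)⁻¹ · γ⁻¹` with `γ` in the subgroup of `G` generated by the `ρ`-images of the letters,
then `w` is not Hurwitz-null — a finite check when `G` is finite. [folklore] -/
theorem not_isHurwitzNull_of_map {G : Type*} [Group G]
    (ρ : MappingClassGroupRelBoundary (𝓡∂ 2) P →* G) {w : List (Letter P o)} (hw : w ≠ [])
    (h : ∀ x ∈ w, ∀ y ∈ w, ∀ γ ∈ Subgroup.closure {c | ∃ z ∈ w, c = ρ (Letter.toClass z)},
      ρ y.toClass ≠ γ * (ρ x.toClass)⁻¹ * γ⁻¹) :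
    ¬ IsHurwitzNull w := by
  refine not_isHurwitzNull_of_forall_ne hw fun x hx y hy k hk hyeq => ?_
  refine h x hx y hy (ρ k) ?_ ?_
  · have hsub : (Subgroup.closure {c | ∃ z ∈ w, c = Letter.toClass z}).map ρ ≤
        Subgroup.closure {c | ∃ z ∈ w, c = ρ (Letter.toClass z)} := by
      rw [MonoidHom.map_closure]
      refine Subgroup.closure_mono ?_
      rintro c ⟨c', ⟨z, hz, rfl⟩, rfl⟩
      exact ⟨z, hz, rfl⟩
    exact hsub (Subgroup.mem_map_of_mem _ hk)
  · rw [hyeq, map_mul, map_mul, map_inv, map_inv]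

end Criterion

end Literature.Topology.FourManifolds

end
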